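import Mathlib

/-!
# HonestZwanzig / NetworkReduction — the Robin optimisation on the path graph

Support file for item `stmt-AtomisticToContinuum-12701` (`NetworkReduction` of route `HonestZwanzig`,
sub-problem `FouriersLaw`): the elementary quadratic optimisation behind the LOWER bound of the
circuit formula. For a backflow vector of the form
`m_y = σ_{y−1} − σ_y + γ([y = 0] + [y = N−1]) τ_y` (bond responses `σ_b`, contact responses `τ_y`)
and the Robin quadratic form `Rob(ξ) = Σ_b (ξ_{b+1} − ξ_b)² + ξ_0² + ξ_{N−1}²` written exactly as in
the route decl `RobinCoercivity`, one has for every `c > 0` and every Ohmic constant `k`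
`2 m·ξ − c·Rob(ξ) ≤ c⁻¹ (Σ_{b+1<N} (σ_b − k)² + (γτ_0 − k)² + (γτ_{N−1} + k)²)`
(`robin_sup_bound`): summation by parts moves `σ` onto the bond differences, the constant `k`
telescopes to the two ends, and each term is a completed square. Pure algebra over `Fin N`.
-/
namespace Summit.AtomisticToContinuum.FouriersLaw.Theorems.HonestZwanzig.NetworkReduction

open Finset Matrix

/-! ### Quadratic optimisation on the path graph with Robin ends -/

/-- `2uv − cv² ≤ u²/c` for `c > 0` (complete the square). -/
theorem two_mul_mul_sub_mul_sq_le {c : ℝ} (hc : 0 < c) (u v : ℝ) :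
    2 * u * v - c * v ^ 2 ≤ u ^ 2 / c := by
  rw [le_div_iff₀ hc]
  nlinarith [sq_nonneg (u - c * v)]

/-- A sum over `Fin N` of a summand supported at `i.val = n` is the value there. -/
theorem sum_ite_val_eq {N : ℕ} (n : ℕ) (hn : n < N) (f : Fin N → ℝ) :
    (∑ i : Fin N, if i.val = n then f i else 0) = f ⟨n, hn⟩ := by
  rw [Finset.sum_eq_single ⟨n, hn⟩]
  · simp
  · intro b _ hb
    rw [if_neg]
    intro h
    exact hb (Fin.ext h)
  · intro h
    exact absurd (Finset.mem_univ _) h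

/-- The shifted value `ξ_{b+1}` written as a sum (`0` past the last site). -/
theorem sum_ite_succ_eq {N : ℕ} (ξ : Fin N → ℝ) (b : Fin N) (hb : b.val + 1 < N) :
    (∑ y : Fin N, if y.val = b.val + 1 then ξ y else 0) = ξ ⟨b.val + 1, hb⟩ :=
  sum_ite_val_eq (b.val + 1) hb ξ

/-- Past the last site the shifted value is `0`. -/
theorem sum_ite_succ_eq_zero {N : ℕ} (ξ : Fin N → ℝ) (b : Fin N) (hb : ¬ b.val + 1 < N) :
    (∑ y : Fin N, if y.val = b.val + 1 then ξ y else 0) = 0 := by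
  refine Finset.sum_eq_zero fun y _ => ?_
  rw [if_neg]
  intro h
  exact hb (h ▸ y.isLt)

/-- The value at the predecessor `σ_{y-1}` written as a sum, for `y ≠ 0`. -/
theorem sum_ite_pred_eq {N : ℕ} (σ : Fin N → ℝ) (y : Fin N) (hy : ¬ y.val = 0) :
    (∑ b : Fin N, if y.val = b.val + 1 then σ b else 0) =
      σ ⟨y.val - 1, by omega⟩ := by
  have hy1 : y.val - 1 < N := by omega
  rw [Finset.sum_eq_single ⟨y.val - 1, hy1⟩]
  · rw [if_pos]
    simp
    omega
  · intro b _ hb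
    rw [if_neg]
    intro h
    apply hb
    ext
    simp
    omega
  · intro h
    exact absurd (Finset.mem_univ _) h

/-- At the left end there is no predecessor. -/
theorem sum_ite_pred_eq_zero {N : ℕ} (σ : Fin N → ℝ) (y : Fin N) (hy : y.val = 0) :
    (∑ b : Fin N, if y.val = b.val + 1 then σ b else 0) = 0 := by
  refine Finset.sum_eq_zero fun b _ => ?_
  rw [if_neg]
  omega

/-- **Robin optimisation, `k = 0`.** For `m_y = Σ_b [y = b+1] σ_b − σ_y + [y = 0] A + [y = N−1] B`
with `σ_{N−1} = 0`: `2 m·ξ − c·Rob(ξ) ≤ c⁻¹ (Σ_b σ_b² + A² + B²)`, where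
`Rob(ξ) = Σ_b (ξ_{b+1} − ξ_b)² + ξ_0² + ξ_{N−1}²` is written exactly as in `RobinCoercivity`. -/
theorem robin_sup_bound_zero {N : ℕ} (hN : 2 ≤ N) {c : ℝ} (hc : 0 < c) (σ ξ : Fin N → ℝ)
    (A B : ℝ) (hσ : ∀ b : Fin N, ¬ b.val + 1 < N → σ b = 0) :
    2 * (∑ y : Fin N, ((∑ b : Fin N, if y.val = b.val + 1 then σ b else 0) - σ y +
        (if y.val = 0 then A else 0) + (if y.val = N - 1 then B else 0)) * ξ y) -
      c * (∑ i : Fin N, ((∑ j : Fin N, if j.val = i.val + 1 then (ξ j - ξ i) ^ 2 else 0) +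
        (if i.val = 0 then ξ i ^ 2 else 0) + (if i.val = N - 1 then ξ i ^ 2 else 0))) ≤
      (1 / c) * ((∑ b : Fin N, σ b ^ 2) + A ^ 2 + B ^ 2) := by
  have h0 : 0 < N := by omega
  have hN1 : N - 1 < N := by omega
  -- the bond differences `δ_b = ξ_{b+1} − ξ_b` (with `ξ_N := 0`)
  set δ : Fin N → ℝ := fun b => (∑ y : Fin N, if y.val = b.val + 1 then ξ y else 0) - ξ b with hδ
  -- pairing: Σ_y m_y ξ_y = Σ_b σ_b δ_b + A ξ_0 + B ξ_{N-1}
  have hpair : (∑ y : Fin N, ((∑ b : Fin N, if y.val = b.val + 1 then σ b else 0) - σ y +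
        (if y.val = 0 then A else 0) + (if y.val = N - 1 then B else 0)) * ξ y) =
      (∑ b : Fin N, σ b * δ b) + A * ξ ⟨0, h0⟩ + B * ξ ⟨N - 1, hN1⟩ := by
    have h1 : ∀ y : Fin N, ((∑ b : Fin N, if y.val = b.val + 1 then σ b else 0) - σ y +
        (if y.val = 0 then A else 0) + (if y.val = N - 1 then B else 0)) * ξ y =
        (∑ b : Fin N, if y.val = b.val + 1 then σ b * ξ y else 0) - σ y * ξ y +
          (if y.val = 0 then A * ξ y else 0) + (if y.val = N - 1 then B * ξ y else 0) := by
      intro y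
      rw [add_mul, add_mul, sub_mul, Finset.sum_mul]
      congr 1
      · congr 1
        · congr 1
          refine Finset.sum_congr rfl fun b _ => ?_
          split_ifs <;> simp
        · split_ifs <;> simp
      · split_ifs <;> simp
    simp_rw [h1]
    rw [Finset.sum_add_distrib, Finset.sum_add_distrib, Finset.sum_sub_distrib,
      sum_ite_val_eq 0 h0, sum_ite_val_eq (N - 1) hN1, Finset.sum_comm]
    have h2 : ∀ b : Fin N, (∑ y : Fin N, if y.val = b.val + 1 then σ b * ξ y else 0) =
        σ b * ∑ y : Fin N, if y.val = b.val + 1 then ξ y else 0 := by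
      intro b
      rw [Finset.mul_sum]
      refine Finset.sum_congr rfl fun y _ => ?_
      split_ifs <;> simp
    simp_rw [h2]
    have h3 : (∑ b : Fin N, σ b * ∑ y : Fin N, if y.val = b.val + 1 then ξ y else 0) -
        ∑ y : Fin N, σ y * ξ y = ∑ b : Fin N, σ b * δ b := by
      rw [← Finset.sum_sub_distrib]
      refine Finset.sum_congr rfl fun b _ => ?_
      rw [hδ]
      ring
    rw [h3]
  -- the Robin form through `δ`
  have hrob : (∑ i : Fin N, ((∑ j : Fin N, if j.val = i.val + 1 then (ξ j - ξ i) ^ 2 else 0) +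
        (if i.val = 0 then ξ i ^ 2 else 0) + (if i.val = N - 1 then ξ i ^ 2 else 0))) =
      (∑ i : Fin N, if i.val + 1 < N then δ i ^ 2 else 0) + ξ ⟨0, h0⟩ ^ 2 + ξ ⟨N - 1, hN1⟩ ^ 2 := by
    rw [Finset.sum_add_distrib, Finset.sum_add_distrib,
      sum_ite_val_eq 0 h0 (fun i => ξ i ^ 2), sum_ite_val_eq (N - 1) hN1 (fun i => ξ i ^ 2)]
    congr 2
    refine Finset.sum_congr rfl fun i _ => ?_
    by_cases hi : i.val + 1 < N
    · rw [if_pos hi, sum_ite_val_eq (i.val + 1) hi (fun j => (ξ j - ξ i) ^ 2), hδ]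
      simp only
      rw [sum_ite_succ_eq ξ i hi]
    · rw [if_neg hi]
      refine Finset.sum_eq_zero fun j _ => ?_
      rw [if_neg]
      intro h
      exact hi (h ▸ j.isLt)
  rw [hpair, hrob]
  -- termwise completion of squares
  have hb : ∀ i : Fin N, 2 * (σ i * δ i) - c * (if i.val + 1 < N then δ i ^ 2 else 0) ≤
      σ i ^ 2 / c := by
    intro i
    by_cases hi : i.val + 1 < N
    · rw [if_pos hi]
      have := two_mul_mul_sub_mul_sq_le hc (σ i) (δ i)
      linarith
    · rw [if_neg hi, hσ i hi]
      simp
  have hsum : 2 * (∑ b : Fin N, σ b * δ b) - c * (∑ i : Fin N, if i.val + 1 < N then δ i ^ 2 else 0)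
      ≤ ∑ b : Fin N, σ b ^ 2 / c := by
    rw [Finset.mul_sum, Finset.mul_sum, ← Finset.sum_sub_distrib]
    exact Finset.sum_le_sum fun i _ => hb i
  have hA := two_mul_mul_sub_mul_sq_le hc A (ξ ⟨0, h0⟩)
  have hB := two_mul_mul_sub_mul_sq_le hc B (ξ ⟨N - 1, hN1⟩)
  have hdiv : (∑ b : Fin N, σ b ^ 2 / c) = (1 / c) * ∑ b : Fin N, σ b ^ 2 := by
    rw [Finset.mul_sum]
    refine Finset.sum_congr rfl fun b _ => ?_
    ring
  rw [hdiv] at hsum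
  have hA' : A ^ 2 / c = (1 / c) * A ^ 2 := by ring
  have hB' : B ^ 2 / c = (1 / c) * B ^ 2 := by ring
  rw [hA'] at hA
  rw [hB'] at hB
  nlinarith [hsum, hA, hB]

/-- **Robin optimisation with the Ohmic shift `k`.** For
`m_y = Σ_b [y = b+1] σ_b − σ_y + γ([y = 0] + [y = N−1]) τ_y` with `σ_{N−1} = 0` and any `k`:
`2 m·ξ − c·Rob(ξ) ≤ c⁻¹ (Σ_{b+1<N} (σ_b − k)² + (γτ_0 − k)² + (γτ_{N−1} + k)²)` — the constant
current `k` telescopes to the two ends, where the Robin terms absorb it. -/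
theorem robin_sup_bound {N : ℕ} (hN : 2 ≤ N) {c : ℝ} (hc : 0 < c) (γ k : ℝ) (σ τ ξ : Fin N → ℝ)
    (hσ : ∀ b : Fin N, ¬ b.val + 1 < N → σ b = 0) :
    2 * (∑ y : Fin N, ((∑ b : Fin N, if y.val = b.val + 1 then σ b else 0) - σ y +
        γ * (((if y.val = 0 then 1 else 0) + (if y.val = N - 1 then 1 else 0)) * τ y)) * ξ y) -
      c * (∑ i : Fin N, ((∑ j : Fin N, if j.val = i.val + 1 then (ξ j - ξ i) ^ 2 else 0) +
        (if i.val = 0 then ξ i ^ 2 else 0) + (if i.val = N - 1 then ξ i ^ 2 else 0))) ≤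
      (1 / c) * ((∑ b : Fin N, if b.val + 1 < N then (σ b - k) ^ 2 else 0) +
        (γ * τ ⟨0, by omega⟩ - k) ^ 2 + (γ * τ ⟨N - 1, by omega⟩ + k) ^ 2) := by
  have h0 : 0 < N := by omega
  have hN1 : N - 1 < N := by omega
  -- shifted bond responses
  set σ' : Fin N → ℝ := fun b => if b.val + 1 < N then σ b - k else 0 with hσ'
  have hσ'0 : ∀ b : Fin N, ¬ b.val + 1 < N → σ' b = 0 := fun b hb => by
    simp only [hσ', if_neg hb]
  have key := robin_sup_bound_zero hN hc σ' ξ (γ * τ ⟨0, h0⟩ - k) (γ * τ ⟨N - 1, hN1⟩ + k) hσ'0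
  have hσ'v : ∀ b : Fin N, b.val + 1 < N → σ' b = σ b - k := fun b hb => by
    simp only [hσ', if_pos hb]
  -- the two `m` vectors coincide
  have hm : ∀ y : Fin N, (∑ b : Fin N, if y.val = b.val + 1 then σ b else 0) - σ y +
        γ * (((if y.val = 0 then 1 else 0) + (if y.val = N - 1 then 1 else 0)) * τ y) =
      (∑ b : Fin N, if y.val = b.val + 1 then σ' b else 0) - σ' y +
        (if y.val = 0 then γ * τ ⟨0, h0⟩ - k else 0) +
        (if y.val = N - 1 then γ * τ ⟨N - 1, hN1⟩ + k else 0) := by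
    intro y
    by_cases hy : y.val = 0
    · -- left end
      have hne : ¬ y.val = N - 1 := by omega
      have hlt : y.val + 1 < N := by omega
      have hy' : (⟨0, h0⟩ : Fin N) = y := Fin.ext hy.symm
      rw [sum_ite_pred_eq_zero σ y hy, sum_ite_pred_eq_zero σ' y hy, if_pos hy, if_neg hne,
        if_pos hy, if_neg hne, hσ'v y hlt, hy']
      ring
    · have hy1 : y.val - 1 < N := by omega
      have hprev : (⟨y.val - 1, hy1⟩ : Fin N).val + 1 < N := by simp; omega
      rw [sum_ite_pred_eq σ y hy, sum_ite_pred_eq σ' y hy, if_neg hy, if_neg hy,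
        hσ'v _ hprev]
      by_cases hy2 : y.val + 1 < N
      · -- bulk
        have hne : ¬ y.val = N - 1 := by omega
        rw [if_neg hne, if_neg hne, hσ'v y hy2]
        ring
      · -- right end
        have heq : y.val = N - 1 := by omega
        have hy' : (⟨N - 1, hN1⟩ : Fin N) = y := Fin.ext heq.symm
        rw [if_pos heq, if_pos heq, hσ y hy2, hσ'0 y hy2, hy']
        ring
  have hsq : (∑ b : Fin N, σ' b ^ 2) = ∑ b : Fin N, if b.val + 1 < N then (σ b - k) ^ 2 else 0 := by
    refine Finset.sum_congr rfl fun b _ => ?_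
    simp only [hσ']
    split_ifs <;> simp
  simp_rw [hm]
  rw [← hsq]
  exact key

end Summit.AtomisticToContinuum.FouriersLaw.Theorems.HonestZwanzig.NetworkReduction
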